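import Literature.NumberTheory.LFunctions.DeBruijnNewmanProofs
import HarnessLib

/-!
# The heat flow of `H_t`: moments, the backwards heat equation, joint regularity

Trunk T-ANT (`Literature/NumberTheory/LFunctions`), companion of `DeBruijnNewmanProofs.lean`
(which proves that each `H_t(z) = ∫₀^∞ e^{tu²} Φ(u) cos(zu) du` is entire, with
`H_t'(z) = −∫₀^∞ u e^{tu²} Φ(u) sin(zu) du`, and that `(t, z) ↦ H_t(z)` is continuous). Here the
same dominated-convergence argument is run for all the weighted moments

  `C_k(t, z) = ∫₀^∞ u^k e^{tu²} Φ(u) cos(zu) du`,  `S_k(t, z) = ∫₀^∞ u^k e^{tu²} Φ(u) sin(zu) du`,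

giving `∂_z C_k = −S_{k+1}`, `∂_z S_k = C_{k+1}`, `∂_t C_k = C_{k+2}`, `∂_t S_k = S_{k+2}` and the
joint continuity of every `C_k`, `S_k` in `(t, z)`. In particular (`H_t = C_0`):

* `Literature.NumberTheory.LFunctions.hasDerivAt_deBruijnH_time` — **the backwards heat equation** `∂_t H_t(z) = −H_t''(z)`
  (Polymath 15, Res. Math. Sci. 6 (2019), eq. (back) in the proof of Prop. 3.1: "from (htdef) and
  differentiation under the integral sign ... we have the backwards heat equation
  `∂_t H_t = −H_t''`"), in the form `∂_t H_t(z) = C_2(t, z)`, `H_t'' = −C_2`;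
* `Literature.NumberTheory.LFunctions.hasDerivAt_deriv_deBruijnH_time` — `∂_t H_t'(z) = −S_3(t, z) = (∂_t H_t)'(z)` (equality of
  the mixed partials, both computed as integrals);
* joint continuity of `H_t(z)`, `H_t'(z)`, `∂_t H_t(z)` and `∂_t H_t'(z)` in `(t, z)`.

These are the regularity inputs of the zero-dynamics arguments of Polymath 15, §3.

## References

* D. H. J. Polymath, *Effective approximation of heat flow evolution of the Riemann `ξ` function,
  and a new upper bound for the de Bruijn–Newman constant*, Res. Math. Sci. 6 (2019), §3,
  proof of Prop. 3.1 (arXiv:1904.12438).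
* N. G. de Bruijn, *The roots of trigonometric integrals*, Duke Math. J. 17 (1950) 197–226.
-/

noncomputable section

open Complex MeasureTheory Set Filter Topology

namespace Literature.NumberTheory.LFunctions

/-! ## The weighted kernels and moments -/

/-- The weight `u^k e^{tu²} Φ(u)`. [cite: Polymath2019, §3] -/
def heatWeight (k : ℕ) (t u : ℝ) : ℝ :=
  u ^ k * (Real.exp (t * u ^ 2) * deBruijnPhi u)

/-- The integrand `u^k e^{tu²} Φ(u) cos(zu)` of the cosine moment `C_k(t, z)`.
[cite: Polymath2019, §3] -/
def cosMomentIntegrand (k : ℕ) (t : ℝ) (z : ℂ) (u : ℝ) : ℂ :=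
  (heatWeight k t u : ℂ) * Complex.cos (z * u)

/-- The integrand `u^k e^{tu²} Φ(u) sin(zu)` of the sine moment `S_k(t, z)`.
[cite: Polymath2019, §3] -/
def sinMomentIntegrand (k : ℕ) (t : ℝ) (z : ℂ) (u : ℝ) : ℂ :=
  (heatWeight k t u : ℂ) * Complex.sin (z * u)

/-- The cosine moment `C_k(t, z) = ∫₀^∞ u^k e^{tu²} Φ(u) cos(zu) du` (`C_0 = H_t`).
[cite: Polymath2019, §3] -/
def cosMoment (k : ℕ) (t : ℝ) (z : ℂ) : ℂ :=
  ∫ u in Ioi (0 : ℝ), cosMomentIntegrand k t z u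

/-- The sine moment `S_k(t, z) = ∫₀^∞ u^k e^{tu²} Φ(u) sin(zu) du` (`H_t' = −S_1`).
[cite: Polymath2019, §3] -/
def sinMoment (k : ℕ) (t : ℝ) (z : ℂ) : ℂ :=
  ∫ u in Ioi (0 : ℝ), sinMomentIntegrand k t z u

/-- `C_0(t, ·) = H_t`. [folklore] -/
theorem cosMoment_zero (t : ℝ) (z : ℂ) : cosMoment 0 t z = deBruijnH t z := by
  rw [deBruijnH_eq_integral, cosMoment]
  refine setIntegral_congr_fun measurableSet_Ioi fun u _ ↦ ?_
  simp [cosMomentIntegrand, deBruijnHIntegrand, heatWeight]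

/-- `u · (u^k e^{tu²} Φ(u)) = u^{k+1} e^{tu²} Φ(u)`. [folklore] -/
theorem heatWeight_succ (k : ℕ) (t u : ℝ) : heatWeight (k + 1) t u = u * heatWeight k t u := by
  simp only [heatWeight, pow_succ]; ring

/-- `u² · (u^k e^{tu²} Φ(u)) = u^{k+2} e^{tu²} Φ(u)`. [folklore] -/
theorem heatWeight_add_two (k : ℕ) (t u : ℝ) :
    heatWeight (k + 2) t u = u ^ 2 * heatWeight k t u := by
  simp only [heatWeight, pow_add]; ring

/-! ## Domination -/

/-- `u^k ≤ e^{ku}` for `u ≥ 0`. [folklore] -/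
theorem pow_le_exp_nat_mul (k : ℕ) {u : ℝ} (hu : 0 ≤ u) : u ^ k ≤ Real.exp (k * u) := by
  rw [Real.exp_nat_mul]
  exact pow_le_pow_left₀ hu (by linarith [Real.add_one_le_exp u]) k

/-- `|u^k e^{tu²} Φ(u)| e^{Y u} ≤ e^{Tu²} |Φ(u)| e^{(Y + k) u}` for `u ≥ 0`, `t ≤ T`. [folklore] -/
theorem abs_heatWeight_mul_exp_le {k : ℕ} {t T Y u : ℝ} (ht : t ≤ T) (hu : 0 ≤ u) :
    |heatWeight k t u| * Real.exp (Y * u) ≤ deBruijnHBound T (Y + k) u := by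
  rw [heatWeight, abs_mul, abs_mul, abs_of_nonneg (pow_nonneg hu k), abs_of_pos (Real.exp_pos _),
    deBruijnHBound]
  have hexp : Real.exp (t * u ^ 2) ≤ Real.exp (T * u ^ 2) := Real.exp_monotone (by nlinarith)
  have hk := pow_le_exp_nat_mul k hu
  calc u ^ k * (Real.exp (t * u ^ 2) * |deBruijnPhi u|) * Real.exp (Y * u)
      ≤ Real.exp (k * u) * (Real.exp (T * u ^ 2) * |deBruijnPhi u|) * Real.exp (Y * u) := by
        gcongr
    _ = Real.exp (T * u ^ 2) * |deBruijnPhi u| * Real.exp ((Y + k) * u) := by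
        rw [add_mul, Real.exp_add]; ring

/-- `|Im (zu)| = |Im z| u ≤ Y u` bounds `‖cos(zu)‖` and `‖sin(zu)‖` by `e^{Yu}`. [folklore] -/
theorem norm_cos_mul_le_exp {z : ℂ} {Y u : ℝ} (hz : |z.im| ≤ Y) (hu : 0 ≤ u) :
    ‖Complex.cos (z * u)‖ ≤ Real.exp (Y * u) := by
  refine (norm_cos_le_exp_abs_im _).trans (Real.exp_monotone ?_)
  rw [show (z * (u : ℂ)).im = z.im * u by simp, abs_mul, abs_of_nonneg hu]
  exact mul_le_mul_of_nonneg_right hz hu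

/-- See `norm_cos_mul_le_exp`. [folklore] -/
theorem norm_sin_mul_le_exp {z : ℂ} {Y u : ℝ} (hz : |z.im| ≤ Y) (hu : 0 ≤ u) :
    ‖Complex.sin (z * u)‖ ≤ Real.exp (Y * u) := by
  refine (norm_sin_le_exp_abs_im _).trans (Real.exp_monotone ?_)
  rw [show (z * (u : ℂ)).im = z.im * u by simp, abs_mul, abs_of_nonneg hu]
  exact mul_le_mul_of_nonneg_right hz hu

/-- Domination of the cosine-moment integrand:
`‖u^k e^{tu²} Φ(u) cos(zu)‖ ≤ e^{Tu²} |Φ(u)| e^{(Y+k)u}` for `u ≥ 0`, `t ≤ T`, `|Im z| ≤ Y`.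
[folklore] -/
theorem norm_cosMomentIntegrand_le {k : ℕ} {t T Y : ℝ} {z : ℂ} (ht : t ≤ T) (hz : |z.im| ≤ Y)
    {u : ℝ} (hu : 0 ≤ u) : ‖cosMomentIntegrand k t z u‖ ≤ deBruijnHBound T (Y + k) u := by
  rw [cosMomentIntegrand, norm_mul, Complex.norm_real, Real.norm_eq_abs]
  exact (mul_le_mul_of_nonneg_left (norm_cos_mul_le_exp hz hu) (abs_nonneg _)).trans
    (abs_heatWeight_mul_exp_le ht hu)

/-- Domination of the sine-moment integrand. [folklore] -/
theorem norm_sinMomentIntegrand_le {k : ℕ} {t T Y : ℝ} {z : ℂ} (ht : t ≤ T) (hz : |z.im| ≤ Y)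
    {u : ℝ} (hu : 0 ≤ u) : ‖sinMomentIntegrand k t z u‖ ≤ deBruijnHBound T (Y + k) u := by
  rw [sinMomentIntegrand, norm_mul, Complex.norm_real, Real.norm_eq_abs]
  exact (mul_le_mul_of_nonneg_left (norm_sin_mul_le_exp hz hu) (abs_nonneg _)).trans
    (abs_heatWeight_mul_exp_le ht hu)

/-! ## Continuity and integrability of the integrands -/

/-- `u ↦ u^k e^{tu²} Φ(u)` is continuous on `[0, ∞)`. [folklore] -/
theorem continuousOn_heatWeight (k : ℕ) (t : ℝ) : ContinuousOn (heatWeight k t) (Ici 0) :=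
  ((continuous_pow k).continuousOn).mul
    ((by fun_prop : Continuous fun u : ℝ ↦ Real.exp (t * u ^ 2)).continuousOn.mul
      continuousOn_deBruijnPhi_Ici)

/-- `(t, u) ↦ u^k e^{tu²} Φ(u)` is continuous on `ℝ × [0, ∞)`. [folklore] -/
theorem continuousOn_heatWeight_uncurry (k : ℕ) :
    ContinuousOn (fun p : ℝ × ℝ ↦ heatWeight k p.1 p.2) {p | 0 ≤ p.2} := by
  have h1 : Continuous fun p : ℝ × ℝ ↦ p.2 ^ k * Real.exp (p.1 * p.2 ^ 2) := by fun_prop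
  have h2 : ContinuousOn (fun p : ℝ × ℝ ↦ deBruijnPhi p.2) {p | 0 ≤ p.2} :=
    continuousOn_deBruijnPhi_Ici.comp continuous_snd.continuousOn fun p hp ↦ hp
  have := h1.continuousOn.mul h2
  refine this.congr fun p _ ↦ ?_
  simp only [heatWeight, Pi.mul_apply]; ring

/-- The cosine-moment integrand is continuous on `(0, ∞)`. [folklore] -/
theorem continuousOn_cosMomentIntegrand (k : ℕ) (t : ℝ) (z : ℂ) :
    ContinuousOn (cosMomentIntegrand k t z) (Ioi 0) :=
  (Complex.continuous_ofReal.comp_continuousOn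
    ((continuousOn_heatWeight k t).mono Ioi_subset_Ici_self)).mul
    (continuous_cos_const_mul z).continuousOn

/-- The sine-moment integrand is continuous on `(0, ∞)`. [folklore] -/
theorem continuousOn_sinMomentIntegrand (k : ℕ) (t : ℝ) (z : ℂ) :
    ContinuousOn (sinMomentIntegrand k t z) (Ioi 0) :=
  (Complex.continuous_ofReal.comp_continuousOn
    ((continuousOn_heatWeight k t).mono Ioi_subset_Ici_self)).mul
    (Complex.continuous_sin.comp (continuous_const.mul Complex.continuous_ofReal)).continuousOn

/-- Measurability of the cosine-moment integrand on `(0, ∞)`. [folklore] -/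
theorem aestronglyMeasurable_cosMomentIntegrand (k : ℕ) (t : ℝ) (z : ℂ) :
    AEStronglyMeasurable (cosMomentIntegrand k t z) (volume.restrict (Ioi 0)) :=
  (continuousOn_cosMomentIntegrand k t z).aestronglyMeasurable measurableSet_Ioi

/-- Measurability of the sine-moment integrand on `(0, ∞)`. [folklore] -/
theorem aestronglyMeasurable_sinMomentIntegrand (k : ℕ) (t : ℝ) (z : ℂ) :
    AEStronglyMeasurable (sinMomentIntegrand k t z) (volume.restrict (Ioi 0)) :=
  (continuousOn_sinMomentIntegrand k t z).aestronglyMeasurable measurableSet_Ioi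

/-- The cosine moments converge absolutely. [folklore] -/
theorem integrableOn_cosMomentIntegrand (k : ℕ) (t : ℝ) (z : ℂ) :
    IntegrableOn (cosMomentIntegrand k t z) (Ioi 0) :=
  (integrableOn_deBruijnHBound t (|z.im| + k)).mono' (aestronglyMeasurable_cosMomentIntegrand k t z)
    (ae_restrict_of_forall_mem measurableSet_Ioi fun _ hu ↦
      norm_cosMomentIntegrand_le le_rfl le_rfl (le_of_lt hu))

/-- The sine moments converge absolutely. [folklore] -/
theorem integrableOn_sinMomentIntegrand (k : ℕ) (t : ℝ) (z : ℂ) :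
    IntegrableOn (sinMomentIntegrand k t z) (Ioi 0) :=
  (integrableOn_deBruijnHBound t (|z.im| + k)).mono' (aestronglyMeasurable_sinMomentIntegrand k t z)
    (ae_restrict_of_forall_mem measurableSet_Ioi fun _ hu ↦
      norm_sinMomentIntegrand_le le_rfl le_rfl (le_of_lt hu))

/-! ## Derivatives of the integrands -/

/-- `∂_z [u^k e^{tu²} Φ(u) cos(zu)] = −u^{k+1} e^{tu²} Φ(u) sin(zu)`. [folklore] -/
theorem hasDerivAt_cosMomentIntegrand_z (k : ℕ) (t u : ℝ) (z : ℂ) :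
    HasDerivAt (fun w : ℂ ↦ cosMomentIntegrand k t w u) (-sinMomentIntegrand (k + 1) t z u) z := by
  have h : HasDerivAt (fun w : ℂ ↦ cosMomentIntegrand k t w u)
      ((heatWeight k t u : ℂ) * (-Complex.sin (z * u) * u)) z :=
    ((hasDerivAt_mul_const (u : ℂ)).ccos).const_mul ((heatWeight k t u : ℝ) : ℂ)
  refine h.congr_deriv ?_
  rw [sinMomentIntegrand, heatWeight_succ]; push_cast; ring

/-- `∂_z [u^k e^{tu²} Φ(u) sin(zu)] = u^{k+1} e^{tu²} Φ(u) cos(zu)`. [folklore] -/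
theorem hasDerivAt_sinMomentIntegrand_z (k : ℕ) (t u : ℝ) (z : ℂ) :
    HasDerivAt (fun w : ℂ ↦ sinMomentIntegrand k t w u) (cosMomentIntegrand (k + 1) t z u) z := by
  have h : HasDerivAt (fun w : ℂ ↦ sinMomentIntegrand k t w u)
      ((heatWeight k t u : ℂ) * (Complex.cos (z * u) * u)) z :=
    ((hasDerivAt_mul_const (u : ℂ)).csin).const_mul ((heatWeight k t u : ℝ) : ℂ)
  refine h.congr_deriv ?_
  rw [cosMomentIntegrand, heatWeight_succ]; push_cast; ring

/-- `∂_t [u^k e^{tu²} Φ(u)] = u^{k+2} e^{tu²} Φ(u)`. [folklore] -/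
theorem hasDerivAt_heatWeight_t (k : ℕ) (t u : ℝ) :
    HasDerivAt (fun s : ℝ ↦ heatWeight k s u) (heatWeight (k + 2) t u) t := by
  have h : HasDerivAt (fun s : ℝ ↦ Real.exp (s * u ^ 2)) (Real.exp (t * u ^ 2) * u ^ 2) t := by
    simpa using ((hasDerivAt_id t).mul_const (u ^ 2)).exp
  have h2 : HasDerivAt (fun s : ℝ ↦ heatWeight k s u)
      (u ^ k * (Real.exp (t * u ^ 2) * u ^ 2 * deBruijnPhi u)) t :=
    (h.mul_const (deBruijnPhi u)).const_mul (u ^ k)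
  refine h2.congr_deriv ?_
  rw [heatWeight_add_two, heatWeight]; ring

/-- `∂_t [u^k e^{tu²} Φ(u) cos(zu)] = u^{k+2} e^{tu²} Φ(u) cos(zu)`. [folklore] -/
theorem hasDerivAt_cosMomentIntegrand_t (k : ℕ) (t u : ℝ) (z : ℂ) :
    HasDerivAt (fun s : ℝ ↦ cosMomentIntegrand k s z u) (cosMomentIntegrand (k + 2) t z u) t := by
  unfold cosMomentIntegrand
  exact ((hasDerivAt_heatWeight_t k t u).ofReal_comp).mul_const _

/-- `∂_t [u^k e^{tu²} Φ(u) sin(zu)] = u^{k+2} e^{tu²} Φ(u) sin(zu)`. [folklore] -/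
theorem hasDerivAt_sinMomentIntegrand_t (k : ℕ) (t u : ℝ) (z : ℂ) :
    HasDerivAt (fun s : ℝ ↦ sinMomentIntegrand k s z u) (sinMomentIntegrand (k + 2) t z u) t := by
  unfold sinMomentIntegrand
  exact ((hasDerivAt_heatWeight_t k t u).ofReal_comp).mul_const _

/-! ## Differentiation under the integral sign -/

/-- `|s| ≤ |t| + 1`-type control on a real ball: `s ∈ ball t 1 ⟹ s ≤ t + 1`. [folklore] -/
theorem le_add_one_of_mem_ball {s t : ℝ} (hs : s ∈ Metric.ball t 1) : s ≤ t + 1 := by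
  rw [Metric.mem_ball, Real.dist_eq] at hs
  linarith [le_abs_self (s - t)]

/-- `∂_z C_k(t, z) = −S_{k+1}(t, z)`. [cite: Polymath2019, §3] -/
theorem hasDerivAt_cosMoment_z (k : ℕ) (t : ℝ) (z₀ : ℂ) :
    HasDerivAt (cosMoment k t) (-sinMoment (k + 1) t z₀) z₀ := by
  have h := (hasDerivAt_integral_of_dominated_loc_of_deriv_le (μ := volume.restrict (Ioi 0))
    (F := cosMomentIntegrand k t) (F' := fun w u ↦ -sinMomentIntegrand (k + 1) t w u) (x₀ := z₀)
    (bound := deBruijnHBound t (|z₀.im| + 1 + (k + 1 : ℕ))) (Metric.ball_mem_nhds z₀ one_pos)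
    (Eventually.of_forall fun z ↦ aestronglyMeasurable_cosMomentIntegrand k t z)
    (integrableOn_cosMomentIntegrand k t z₀)
    ((aestronglyMeasurable_sinMomentIntegrand (k + 1) t z₀).neg)
    (ae_restrict_of_forall_mem measurableSet_Ioi fun _ hu _ hz ↦ by
      rw [norm_neg]
      exact norm_sinMomentIntegrand_le le_rfl (abs_im_le_of_mem_ball hz) (le_of_lt hu))
    (integrableOn_deBruijnHBound _ _)
    (ae_restrict_of_forall_mem measurableSet_Ioi fun u _ z _ ↦
      hasDerivAt_cosMomentIntegrand_z k t u z)).2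
  rw [integral_neg] at h
  exact h

/-- `∂_z S_k(t, z) = C_{k+1}(t, z)`. [cite: Polymath2019, §3] -/
theorem hasDerivAt_sinMoment_z (k : ℕ) (t : ℝ) (z₀ : ℂ) :
    HasDerivAt (sinMoment k t) (cosMoment (k + 1) t z₀) z₀ :=
  (hasDerivAt_integral_of_dominated_loc_of_deriv_le (μ := volume.restrict (Ioi 0))
    (F := sinMomentIntegrand k t) (F' := fun w u ↦ cosMomentIntegrand (k + 1) t w u) (x₀ := z₀)
    (bound := deBruijnHBound t (|z₀.im| + 1 + (k + 1 : ℕ))) (Metric.ball_mem_nhds z₀ one_pos)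
    (Eventually.of_forall fun z ↦ aestronglyMeasurable_sinMomentIntegrand k t z)
    (integrableOn_sinMomentIntegrand k t z₀)
    (aestronglyMeasurable_cosMomentIntegrand (k + 1) t z₀)
    (ae_restrict_of_forall_mem measurableSet_Ioi fun _ hu _ hz ↦
      norm_cosMomentIntegrand_le le_rfl (abs_im_le_of_mem_ball hz) (le_of_lt hu))
    (integrableOn_deBruijnHBound _ _)
    (ae_restrict_of_forall_mem measurableSet_Ioi fun u _ z _ ↦
      hasDerivAt_sinMomentIntegrand_z k t u z)).2

/-- `∂_t C_k(t, z) = C_{k+2}(t, z)`. [cite: Polymath2019, §3] -/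
theorem hasDerivAt_cosMoment_t (k : ℕ) (t₀ : ℝ) (z : ℂ) :
    HasDerivAt (fun t ↦ cosMoment k t z) (cosMoment (k + 2) t₀ z) t₀ :=
  (hasDerivAt_integral_of_dominated_loc_of_deriv_le (μ := volume.restrict (Ioi 0))
    (F := fun t ↦ cosMomentIntegrand k t z) (F' := fun t u ↦ cosMomentIntegrand (k + 2) t z u)
    (x₀ := t₀) (bound := deBruijnHBound (t₀ + 1) (|z.im| + (k + 2 : ℕ)))
    (Metric.ball_mem_nhds t₀ one_pos)
    (Eventually.of_forall fun t ↦ aestronglyMeasurable_cosMomentIntegrand k t z)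
    (integrableOn_cosMomentIntegrand k t₀ z)
    (aestronglyMeasurable_cosMomentIntegrand (k + 2) t₀ z)
    (ae_restrict_of_forall_mem measurableSet_Ioi fun _ hu _ ht ↦
      norm_cosMomentIntegrand_le (le_add_one_of_mem_ball ht) le_rfl (le_of_lt hu))
    (integrableOn_deBruijnHBound _ _)
    (ae_restrict_of_forall_mem measurableSet_Ioi fun u _ t _ ↦
      hasDerivAt_cosMomentIntegrand_t k t u z)).2

/-- `∂_t S_k(t, z) = S_{k+2}(t, z)`. [cite: Polymath2019, §3] -/
theorem hasDerivAt_sinMoment_t (k : ℕ) (t₀ : ℝ) (z : ℂ) :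
    HasDerivAt (fun t ↦ sinMoment k t z) (sinMoment (k + 2) t₀ z) t₀ :=
  (hasDerivAt_integral_of_dominated_loc_of_deriv_le (μ := volume.restrict (Ioi 0))
    (F := fun t ↦ sinMomentIntegrand k t z) (F' := fun t u ↦ sinMomentIntegrand (k + 2) t z u)
    (x₀ := t₀) (bound := deBruijnHBound (t₀ + 1) (|z.im| + (k + 2 : ℕ)))
    (Metric.ball_mem_nhds t₀ one_pos)
    (Eventually.of_forall fun t ↦ aestronglyMeasurable_sinMomentIntegrand k t z)
    (integrableOn_sinMomentIntegrand k t₀ z)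
    (aestronglyMeasurable_sinMomentIntegrand (k + 2) t₀ z)
    (ae_restrict_of_forall_mem measurableSet_Ioi fun _ hu _ ht ↦
      norm_sinMomentIntegrand_le (le_add_one_of_mem_ball ht) le_rfl (le_of_lt hu))
    (integrableOn_deBruijnHBound _ _)
    (ae_restrict_of_forall_mem measurableSet_Ioi fun u _ t _ ↦
      hasDerivAt_sinMomentIntegrand_t k t u z)).2

/-! ## Joint continuity in `(t, z)` -/

/-- `(t, z) ↦ C_k(t, z)` is continuous on `ℝ × ℂ`. [folklore] -/
theorem continuous_cosMoment_uncurry (k : ℕ) : Continuous fun p : ℝ × ℂ ↦ cosMoment k p.1 p.2 := by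
  refine continuous_iff_continuousAt.2 fun p₀ ↦ ?_
  change ContinuousAt (fun p : ℝ × ℂ ↦ ∫ u in Ioi (0 : ℝ), cosMomentIntegrand k p.1 p.2 u) p₀
  refine continuousAt_of_dominated (bound := deBruijnHBound (p₀.1 + 1) (|p₀.2.im| + 1 + k))
    (Eventually.of_forall fun p ↦ aestronglyMeasurable_cosMomentIntegrand k p.1 p.2) ?_
    (integrableOn_deBruijnHBound _ _) ?_
  · filter_upwards [Metric.ball_mem_nhds p₀ one_pos] with p hp
    refine ae_restrict_of_forall_mem measurableSet_Ioi fun u hu ↦ ?_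
    rw [← ball_prod_same, Set.mem_prod] at hp
    exact norm_cosMomentIntegrand_le (le_add_one_of_mem_ball hp.1) (abs_im_le_of_mem_ball hp.2)
      (le_of_lt hu)
  · refine ae_restrict_of_forall_mem measurableSet_Ioi fun u (hu : 0 < u) ↦ ?_
    have hc : Continuous fun p : ℝ × ℂ ↦ Complex.cos (p.2 * (u : ℂ)) := by fun_prop
    have hw : Continuous fun p : ℝ × ℂ ↦ ((heatWeight k p.1 u : ℝ) : ℂ) := by
      refine Complex.continuous_ofReal.comp ?_
      have : Continuous fun p : ℝ × ℂ ↦ u ^ k * (Real.exp (p.1 * u ^ 2) * deBruijnPhi u) := by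
        fun_prop
      exact this
    exact (hw.mul hc).continuousAt

/-- `(t, z) ↦ S_k(t, z)` is continuous on `ℝ × ℂ`. [folklore] -/
theorem continuous_sinMoment_uncurry (k : ℕ) : Continuous fun p : ℝ × ℂ ↦ sinMoment k p.1 p.2 := by
  refine continuous_iff_continuousAt.2 fun p₀ ↦ ?_
  change ContinuousAt (fun p : ℝ × ℂ ↦ ∫ u in Ioi (0 : ℝ), sinMomentIntegrand k p.1 p.2 u) p₀
  refine continuousAt_of_dominated (bound := deBruijnHBound (p₀.1 + 1) (|p₀.2.im| + 1 + k))
    (Eventually.of_forall fun p ↦ aestronglyMeasurable_sinMomentIntegrand k p.1 p.2) ?_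
    (integrableOn_deBruijnHBound _ _) ?_
  · filter_upwards [Metric.ball_mem_nhds p₀ one_pos] with p hp
    refine ae_restrict_of_forall_mem measurableSet_Ioi fun u hu ↦ ?_
    rw [← ball_prod_same, Set.mem_prod] at hp
    exact norm_sinMomentIntegrand_le (le_add_one_of_mem_ball hp.1) (abs_im_le_of_mem_ball hp.2)
      (le_of_lt hu)
  · refine ae_restrict_of_forall_mem measurableSet_Ioi fun u (hu : 0 < u) ↦ ?_
    have hc : Continuous fun p : ℝ × ℂ ↦ Complex.sin (p.2 * (u : ℂ)) := by fun_prop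
    have hw : Continuous fun p : ℝ × ℂ ↦ ((heatWeight k p.1 u : ℝ) : ℂ) := by
      refine Complex.continuous_ofReal.comp ?_
      have : Continuous fun p : ℝ × ℂ ↦ u ^ k * (Real.exp (p.1 * u ^ 2) * deBruijnPhi u) := by
        fun_prop
      exact this
    exact (hw.mul hc).continuousAt

/-! ## Consequences for `H_t`: derivatives and the backwards heat equation -/

/-- `H_t'(z) = −S_1(t, z)`. [cite: Polymath2019, §3] -/
theorem hasDerivAt_deBruijnH_eq_sinMoment (t : ℝ) (z : ℂ) :
    HasDerivAt (deBruijnH t) (-sinMoment 1 t z) z := by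
  have h := hasDerivAt_cosMoment_z 0 t z
  have he : cosMoment 0 t = deBruijnH t := funext (cosMoment_zero t)
  rwa [he] at h

/-- `H_t' = −S_1(t, ·)`. [cite: Polymath2019, §3] -/
theorem deriv_deBruijnH (t : ℝ) : deriv (deBruijnH t) = fun z ↦ -sinMoment 1 t z :=
  funext fun z ↦ (hasDerivAt_deBruijnH_eq_sinMoment t z).deriv

/-- `H_t''(z) = −C_2(t, z)`. [cite: Polymath2019, §3] -/
theorem hasDerivAt_deriv_deBruijnH (t : ℝ) (z : ℂ) :
    HasDerivAt (deriv (deBruijnH t)) (-cosMoment 2 t z) z := by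
  rw [deriv_deBruijnH]
  exact (hasDerivAt_sinMoment_z 1 t z).neg

/-- `H_t'' = −C_2(t, ·)`. [cite: Polymath2019, §3] -/
theorem deriv_deriv_deBruijnH (t : ℝ) :
    deriv (deriv (deBruijnH t)) = fun z ↦ -cosMoment 2 t z :=
  funext fun z ↦ (hasDerivAt_deriv_deBruijnH t z).deriv

/-- **The backwards heat equation** `∂_t H_t(z) = −H_t''(z)` (Polymath 15, eq. (back)), in the
form `∂_t H_t(z) = C_2(t, z)` (and `H_t'' = −C_2`, `deriv_deriv_deBruijnH`).
[cite: Polymath2019, §3, eq. (back)] -/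
theorem hasDerivAt_deBruijnH_time (t : ℝ) (z : ℂ) :
    HasDerivAt (fun s ↦ deBruijnH s z) (cosMoment 2 t z) t := by
  have h := hasDerivAt_cosMoment_t 0 t z
  simp only [cosMoment_zero] at h
  exact h

/-- The backwards heat equation with the second derivative spelled out:
`∂_t H_t(z) = −(H_t)''(z)`. [cite: Polymath2019, §3, eq. (back)] -/
theorem hasDerivAt_deBruijnH_time' (t : ℝ) (z : ℂ) :
    HasDerivAt (fun s ↦ deBruijnH s z) (-deriv (deriv (deBruijnH t)) z) t := by
  rw [deriv_deriv_deBruijnH, neg_neg]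
  exact hasDerivAt_deBruijnH_time t z

/-- `∂_t H_t'(z) = −S_3(t, z)`. [cite: Polymath2019, §3] -/
theorem hasDerivAt_deriv_deBruijnH_time (t : ℝ) (z : ℂ) :
    HasDerivAt (fun s ↦ deriv (deBruijnH s) z) (-sinMoment 3 t z) t := by
  simp only [deriv_deBruijnH]
  exact (hasDerivAt_sinMoment_t 1 t z).neg

/-- `(∂_t H_t)'(z) = −S_3(t, z)`: the mixed partials agree (`∂_z C_2 = −S_3 = ∂_t H_t'`).
[cite: Polymath2019, §3] -/
theorem hasDerivAt_cosMoment_two_z (t : ℝ) (z : ℂ) :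
    HasDerivAt (cosMoment 2 t) (-sinMoment 3 t z) z :=
  hasDerivAt_cosMoment_z 2 t z

/-- Joint continuity of `(t, z) ↦ H_t'(z)`. [folklore] -/
theorem continuous_deriv_deBruijnH_uncurry :
    Continuous fun p : ℝ × ℂ ↦ deriv (deBruijnH p.1) p.2 := by
  simp only [deriv_deBruijnH]
  exact (continuous_sinMoment_uncurry 1).neg

/-- Joint continuity of `(t, z) ↦ H_t''(z)`. [folklore] -/
theorem continuous_deriv_deriv_deBruijnH_uncurry :
    Continuous fun p : ℝ × ℂ ↦ deriv (deriv (deBruijnH p.1)) p.2 := by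
  simp only [deriv_deriv_deBruijnH]
  exact (continuous_cosMoment_uncurry 2).neg

end Literature.NumberTheory.LFunctions

end
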